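import Summits.MatrixMultiplication.OmegaCensus.STPP211Z2pow6DirectChunks

/-!
# (2,1,1)¹⁰ ⊄ (ℤ/2)⁶ — part S2 class 06, decisions 3/5: direct search over the hard class #20 of `reps29` (roots d = 48 (part))

Cell `pub-omega` (unit `pub-omega-stpp-1-g37`), topic `Summits/MatrixMultiplication/OmegaCensus`.
HONEST FRAMING (verbatim): lottery ticket; floor = certified bounds/negative ranges. Census STRUCTURE bookkeeping (B5, `T1((ℤ/2)⁶)`, Pb237);
nothing here is a bound on `ω`.

Class #20 of `reps29` in the translated form `C' = hc06 = [0, 7, 11, 13, 14, 15, 24, 31, 40, 47]` (`+ 15`, block of `c = 15` first; linear stabilizer of order 192,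
root representatives [1, 8, 16, 25, 48, 49, 56]; HOME `pub-omega-stpp-1-g36/code/hard_perd.json`). The kernel evaluates the direct engine
(`STPP211Z2pow6DirectEngine.rootD`, soundness `noNF_of_rootD`) in CHUNKS of the root node (`STPP211Z2pow6DirectChunks.rootDX`, ≤ 10⁵ search
calls each, exact counts from the seat's C mirror `godc.c`; this file: 769,169 calls) and assembles `rootD C' d = true` per root by
`rootD_of_chunks`. The class theorem follows in `STPP211Z2pow6Hard06Class` (symmetry transport, `STPP211Z2pow6DirectTransport`).

References: H. Cohn, R. Kleinberg, B. Szegedy, C. Umans, FOCS 2005 (arXiv:math/0511460), Def. 5.1.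
-/

namespace Summit.MatrixMultiplication.OmegaCensus

namespace T1CosetEng

/-- KERNEL: root `d = 48`, chunk 1 (codes `x = 0 … 1` of the branching label's lane; 62,486 search calls). -/
theorem hc06_d48_c1 : rootDX [0, 7, 11, 13, 14, 15, 24, 31, 40, 47] 48 3 = true := by decide +kernel

/-- KERNEL: root `d = 48`, chunk 2 (codes `x = 2 … 2` of the branching label's lane; 60,621 search calls). -/
theorem hc06_d48_c2 : rootDX [0, 7, 11, 13, 14, 15, 24, 31, 40, 47] 48 4 = true := by decide +kernel

/-- KERNEL: root `d = 48`, chunk 3 (codes `x = 3 … 3` of the branching label's lane; 58,747 search calls). -/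
theorem hc06_d48_c3 : rootDX [0, 7, 11, 13, 14, 15, 24, 31, 40, 47] 48 8 = true := by decide +kernel

/-- KERNEL: root `d = 48`, chunk 4 (codes `x = 4 … 8` of the branching label's lane; 65,188 search calls). -/
theorem hc06_d48_c4 : rootDX [0, 7, 11, 13, 14, 15, 24, 31, 40, 47] 48 496 = true := by decide +kernel

/-- KERNEL: root `d = 48`, chunk 5 (codes `x = 9 … 9` of the branching label's lane; 61,440 search calls). -/
theorem hc06_d48_c5 : rootDX [0, 7, 11, 13, 14, 15, 24, 31, 40, 47] 48 512 = true := by decide +kernel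

/-- KERNEL: root `d = 48`, chunk 6 (codes `x = 10 … 16` of the branching label's lane; 91,841 search calls). -/
theorem hc06_d48_c6 : rootDX [0, 7, 11, 13, 14, 15, 24, 31, 40, 47] 48 130048 = true := by decide +kernel

/-- KERNEL: root `d = 48`, chunk 7 (codes `x = 17 … 21` of the branching label's lane; 89,947 search calls). -/
theorem hc06_d48_c7 : rootDX [0, 7, 11, 13, 14, 15, 24, 31, 40, 47] 48 4063232 = true := by decide +kernel

/-- KERNEL: root `d = 48`, chunk 8 (codes `x = 22 … 25` of the branching label's lane; 88,195 search calls). -/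
theorem hc06_d48_c8 : rootDX [0, 7, 11, 13, 14, 15, 24, 31, 40, 47] 48 62914560 = true := by decide +kernel

/-- KERNEL: root `d = 48`, chunk 9 (codes `x = 26 … 28` of the branching label's lane; 96,691 search calls). -/
theorem hc06_d48_c9 : rootDX [0, 7, 11, 13, 14, 15, 24, 31, 40, 47] 48 469762048 = true := by decide +kernel

/-- KERNEL: root `d = 48`, chunk 10 (codes `x = 29 … 33` of the branching label's lane; 94,013 search calls). -/
theorem hc06_d48_c10 : rootDX [0, 7, 11, 13, 14, 15, 24, 31, 40, 47] 48 16642998272 = true := by decide +kernel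

end T1CosetEng

end Summit.MatrixMultiplication.OmegaCensus
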